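/-
Copyright (c) 2026 the pub-hodgecm-mathlib formalisation cell (harness21).  Prover seat hodgecm-mathlib-LH4-p13 (g10), req620 Track A «(D-RAM) FOUR-FRAME» squad
F0∕P3c∕LH4; the (β₂) road (R-36), β₂ WORD #34∕#36 «MIX-HI» (lead LH4-p13): «READ THE CLASS OFF ANY EXACT-LEVEL VALUE» — the band-agnostic read that turns the
label law into a product-class read; helper lane on h413 = stmt-HodgeConjecture-24833 (count-neutral).  2026-09-05.
-/
import Summits.HodgeConjecture.HodgeConjecture.Theorems.F0P3cDyRamConeCellFaceAxis              -- ★ p861154 (LH4-p15): `valueSetMod_smul_xPlus_eq_plus_iff_exists_norm`; brings ★ (L-lab-9) `exists_norm_of_mem_valueSetMod_smul_xPlus`, `smul_refSkewScalar_mem_valueSetMod_smul_xPlus`, ★ `valueSetMod_smul_xPlus`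
import Summits.HodgeConjecture.HodgeConjecture.Theorems.F0P3cDyRamLabelShellFlipCardTwo          -- ★ (LH4-p15) §5: `v_refSkew_eq` (`|t₊| = |ϖ|^{d % 2}`)
import Literature.NumberTheory.LocalFields.ValuedCompleteIsAdicComplete                          -- ★ `isAdicComplete_valuedInteger_of_completeSpace`
import HarnessLib

/-!
# Crux `H413`, line LH4 «(D-RAM) FOUR-FRAME» — the (β₂) road (R-36), β₂ WORD #34∕#36 «MIX-HI»: «READ THE CLASS OFF ANY EXACT-LEVEL VALUE»

Cell `hodgecm-mathlib` (D-0151), FLOOR 0, crux item H413 = `stmt-HodgeConjecture-24833`, route of record `HCCMUnconditional`; squad F0∕P3c∕LH4; lane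
`--supports stmt-HodgeConjecture-24833 --as helper` (count-neutral; pays NO tier-0 row).  THEOREMS ONLY (no `def`, no instance, no notation, no `sorry`, default heartbeats);
★-only imports; states NO census law; the MIX-HI letters, ‹PRODBAL-*›, (ROW) and (β₂) stay HYPOTHESES of their holders.

WHAT (MIX-HI lead rulings 2026-09-05T01:47:37Z (3) ∕ 02:09:21Z: the U∕D product read).  The label law (★ p864014 ∕ ★ p864323) gives every clean-shell vertex a class:
`S = valueSetMod σ ϖ m⋆ (e′ • X₊)` for the `ϖ^{m⋆}`-thickened value set `S = {z ∣ ∃ y ∈ L, |(ϖ^{m⋆})⁻¹(z − val y)| ≤ 1}` of ANY value function `val` on ANY carrier `L`.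
‹PRODBAL›'s product character needs that class READ OFF A COMPUTABLE SCALAR.  On the lower line the ray scalar `e₀ = val(g₀)` does it (★ p863761, LH7-p09 (g3) ★ p864441);
on the UPPER line `e₀` may be deeper than the shell (`m < 2b`), and then some OTHER value carries the class.  THIS FILE is the band-agnostic read, over the bare
set identity (no lattice, no form, no cell):
* §1 `exists_value_exact_of_eq_smul_xPlus` — a set of that shape equal to `valueSetMod σ ϖ m⋆ (e′ • X₊)` CONTAINS A VALUE OF EXACT LEVEL: `∃ y ∈ L, |val y| = |ϖ|^{d % 2}`
  (`e′·t₊` is a member, and members are `ϖ^{m⋆}`-close to values).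
* §2 `exists_norm_of_value_near_fixed` — for ANY value `val y` (`y ∈ L`) and ANY `σ`-fixed unit `e″` with `|val y − e″·t₊| ≤ |ϖ^{m⋆}|`: `e″∕e′ ∈ N(E^×)` — the class of the vertex
  is the class of `e″` (★ (L-lab-9) `exists_norm_of_mem_valueSetMod_smul_xPlus` after one thickening step).
* §3 `eq_plus_iff_exists_norm_of_value_near_fixed` — hence `S = valueSetMod σ ϖ m⋆ X₊ ↔ e″ ∈ N(E^×)`: THE READ.  With ★ `exists_fixed_unit_sub_mul_refSkew_le_any` (Eisenstein
  coordinates) every exact-level value with deep trace HAS such an `e″`; which value is exact on a U-MIX cell (ray scalar or plane value) is the typist's dichotomy.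

HONEST LABEL.  Count-neutral set ∕ valuation algebra; nothing printed is asserted; no census law is stated; ‹U-MIX-2C›, ‹D-MIX-2C› (★ p864456∕p864457), ‹PRODBAL-*› and (β₂)
stay OPEN with their holders (β₂ `stub_law_cleanSgn₂` UNPROVED); `HC_CM` is proved only modulo the 7 printed citations (2 remaining named inputs: hLiu418 =
`stmt-HodgeConjecture-24832`, h413 = `stmt-HodgeConjecture-24833`) until rung 0 closes.

## References
* [Serre1979] J.-P. Serre, *Local Fields*, GTM 67 (1979): Ch. V §3 Cor. 3 (norm classes of units: index two; conductor of a ramified quadratic extension).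
* [Rogawski1990] J. D. Rogawski, *Automorphic Representations of Unitary Groups in Three Variables*, Ann. of Math. Stud. 123 (1990): §4.9 Prop. 4.9.1 (b) p. 55.
* [LanglandsShelstad1987] R. P. Langlands, D. Shelstad, *On the definition of transfer factors*, Math. Ann. 278 (1987): §3 (the sign attached to the two unipotent classes).
-/

set_option autoImplicit false

noncomputable section

namespace Summit.HodgeConjecture.HodgeConjecture.Cruxes.H413.F0P3cDyRamCleanShellLabelRead

open scoped Valued WithZero Matrix
open WithZero
open Literature.NumberTheory.Automorphic.UnitaryThreeFourFrame (IsRamifiedQuadraticDatum)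
open Literature.NumberTheory.LocalFields (isAdicComplete_valuedInteger_of_completeSpace)
open Summit.HodgeConjecture.HodgeConjecture.Cruxes.H413.F0P3cDyRamFourFramePieces (valueSetMod xPlus mstarOfRecord)
open Summit.HodgeConjecture.HodgeConjecture.Cruxes.H413.F0P3cDyRamSmulXPlusLabel (valueSetMod_smul_xPlus)
open Summit.HodgeConjecture.HodgeConjecture.Cruxes.H413.F0P3cDyRamValueSetTwoClassObstruction (exists_norm_of_mem_valueSetMod_smul_xPlus smul_refSkewScalar_mem_valueSetMod_smul_xPlus)
open Summit.HodgeConjecture.HodgeConjecture.Cruxes.H413.F0P3cDyRamLabelShellFlipCardTwo (v_refSkew_eq)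
open Summit.HodgeConjecture.HodgeConjecture.Cruxes.H413.F0P3cDyRamConeCellFaceAxis (valueSetMod_smul_xPlus_eq_plus_iff_exists_norm)

variable {E V : Type} [Field E] [Valued E ℤᵐ⁰]

/-! ## §1  A labelled value set contains a value of exact level -/

/-- **A LABELLED VALUE SET CONTAINS A VALUE OF EXACT LEVEL `ℓ₀ = d % 2`.**  If `{z ∣ ∃ y ∈ L, |(ϖ^{m⋆})⁻¹(z − val y)| ≤ 1} = valueSetMod σ ϖ m⋆ (e′ • X₊)` for a `σ`-fixed
unit `e′` (`m⋆ = mstarOfRecord d`), then some value has `|val y| = |ϖ|^{d % 2}`: the member `e′·t₊` (`|t₊| = |ϖ|^{d % 2}`) is `ϖ^{m⋆}`-close to a value and `m⋆ > d % 2`.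
[cite: Rogawski1990, §4.9 Prop. 4.9.1 (b) p. 55] [cite: Serre1979, Ch. V §3 Cor. 3] -/
theorem exists_value_exact_of_eq_smul_xPlus {σ : E →+* E} {ϖ : E} {d t : ℕ} (hD : IsRamifiedQuadraticDatum σ ϖ d t) (hd1 : 1 ≤ d)
    {L : Set V} {val : V → E} {e' : E} (he'1 : Valued.v e' = 1)
    (hS : {z : E | ∃ y ∈ L, Valued.v ((ϖ ^ mstarOfRecord d)⁻¹ * (z - val y)) ≤ 1} = valueSetMod σ ϖ (mstarOfRecord d) (e' • xPlus σ ϖ d)) :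
    ∃ y ∈ L, Valued.v (val y) = Valued.v ϖ ^ (d % 2) := by
  obtain ⟨-, hvσ, hϖ, -, hdd, -, -⟩ := id hD
  have hvϖ0 : Valued.v ϖ ≠ 0 := by rw [hϖ]; exact exp_ne_zero
  have hϖlt : Valued.v ϖ < 1 := by rw [hϖ, ← exp_zero, exp_lt_exp]; norm_num
  have hvt : Valued.v ((ϖ - σ ϖ) * ((ϖ * σ ϖ) ^ ((d - d % 2) / 2))⁻¹) = Valued.v ϖ ^ (d % 2) := v_refSkew_eq hvσ hϖ hdd
  have hmem : e' * ((ϖ - σ ϖ) * ((ϖ * σ ϖ) ^ ((d - d % 2) / 2))⁻¹) ∈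
      {z : E | ∃ y ∈ L, Valued.v ((ϖ ^ mstarOfRecord d)⁻¹ * (z - val y)) ≤ 1} := by
    rw [hS]; exact smul_refSkewScalar_mem_valueSetMod_smul_xPlus σ ϖ d _ e'
  obtain ⟨y, hy, hz⟩ := hmem
  refine ⟨y, hy, ?_⟩
  have het : Valued.v (e' * ((ϖ - σ ϖ) * ((ϖ * σ ϖ) ^ ((d - d % 2) / 2))⁻¹)) = Valued.v ϖ ^ (d % 2) := by rw [map_mul, he'1, one_mul, hvt]
  have hpm0 : (0 : ℤᵐ⁰) < Valued.v (ϖ ^ mstarOfRecord d) := by rw [map_pow]; exact pow_pos (zero_lt_iff.2 hvϖ0) _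
  have hclose : Valued.v (e' * ((ϖ - σ ϖ) * ((ϖ * σ ϖ) ^ ((d - d % 2) / 2))⁻¹) - val y) ≤ Valued.v (ϖ ^ mstarOfRecord d) := by
    rw [map_mul, map_inv₀, inv_mul_le_iff₀ hpm0, mul_one] at hz; exact hz
  have hlt : Valued.v (e' * ((ϖ - σ ϖ) * ((ϖ * σ ϖ) ^ ((d - d % 2) / 2))⁻¹) - val y) <
      Valued.v (e' * ((ϖ - σ ϖ) * ((ϖ * σ ϖ) ^ ((d - d % 2) / 2))⁻¹)) := by
    rw [het]
    refine hclose.trans_lt ?_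
    rw [map_pow]
    exact pow_lt_pow_right_of_lt_one₀ (zero_lt_iff.2 hvϖ0) hϖlt (by show d % 2 < d % 2 + 2 * d - 1; omega)
  have := Valuation.map_sub_eq_of_lt_left Valued.v hlt
  -- `|e′t₊ − (e′t₊ − val y)| = |e′t₊|`
  rw [sub_sub_cancel] at this
  rw [this, het]

/-! ## §2  The class of the vertex is the class of any fixed approximant of any value -/

/-- **THE CLASS IS READ OFF ANY FIXED APPROXIMANT OF ANY VALUE.**  Complete wild datum; `S = valueSetMod σ ϖ m⋆ (e′ • X₊)` as in §1; `y ∈ L`; `e″` a `σ`-fixed unit with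
`|val y − e″·t₊| ≤ |ϖ^{m⋆}|`.  THEN `e″∕e′ ∈ N(E^×)`: `val y ∈ S`, so `e″·t₊ ∈ S = valueSetMod σ ϖ m⋆ (e′ • X₊)` (one thickening step), and ★ (L-lab-9) reads the quotient.
[cite: Serre1979, Ch. V §3 Cor. 3] [cite: Rogawski1990, §4.9 Prop. 4.9.1 (b) p. 55] [cite: LanglandsShelstad1987, §3] -/
theorem exists_norm_of_value_near_fixed [CompleteSpace E] {σ : E →+* E} {ϖ : E} {d t : ℕ} (hD : IsRamifiedQuadraticDatum σ ϖ d t)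
    {L : Set V} {val : V → E} {e' : E} (he'σ : σ e' = e') (he'1 : Valued.v e' = 1)
    (hS : {z : E | ∃ y ∈ L, Valued.v ((ϖ ^ mstarOfRecord d)⁻¹ * (z - val y)) ≤ 1} = valueSetMod σ ϖ (mstarOfRecord d) (e' • xPlus σ ϖ d))
    {y : V} (hy : y ∈ L) {e'' : E} (he''σ : σ e'' = e'') (he''1 : Valued.v e'' = 1)
    (hclose : Valued.v (val y - e'' * ((ϖ - σ ϖ) * ((ϖ * σ ϖ) ^ ((d - d % 2) / 2))⁻¹)) ≤ Valued.v ϖ ^ mstarOfRecord d) :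
    ∃ z : E, z * σ z = e'' * e'⁻¹ := by
  haveI := isAdicComplete_valuedInteger_of_completeSpace (K := E) hD.2.2.1
  have hϖ : Valued.v ϖ = exp (-1 : ℤ) := hD.2.2.1
  have hvϖ0 : Valued.v ϖ ≠ 0 := by rw [hϖ]; exact exp_ne_zero
  have hpm0 : (0 : ℤᵐ⁰) < Valued.v (ϖ ^ mstarOfRecord d) := by rw [map_pow]; exact pow_pos (zero_lt_iff.2 hvϖ0) _
  -- `e″·t₊ ∈ S`
  have hmem : e'' * ((ϖ - σ ϖ) * ((ϖ * σ ϖ) ^ ((d - d % 2) / 2))⁻¹) ∈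
      {z : E | ∃ y ∈ L, Valued.v ((ϖ ^ mstarOfRecord d)⁻¹ * (z - val y)) ≤ 1} := by
    refine ⟨y, hy, ?_⟩
    rw [map_mul, map_inv₀, inv_mul_le_iff₀ hpm0, mul_one, Valuation.map_sub_swap, map_pow]
    exact hclose
  rw [hS] at hmem
  exact exists_norm_of_mem_valueSetMod_smul_xPlus hD he''σ he''1 he'σ he'1 hmem

/-! ## §3  THE READ: `S = V(X₊) ↔ e″ ∈ N(E^×)` -/

/-- **THE READ.**  Under §2's letters: `S = valueSetMod σ ϖ m⋆ X₊ ↔ ∃ z, z·σz = e″` — the vertex is labelled `+` iff ANY `σ`-fixed `ϖ^{m⋆}`-approximant `e″` of ANY of its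
values (in units of `t₊`) is a norm (§2 + ★ `valueSetMod_smul_xPlus_eq_plus_iff_exists_norm`; norms have index two). [cite: Serre1979, Ch. V §3 Cor. 3] [cite: Rogawski1990, §4.9 Prop. 4.9.1 (b) p. 55] -/
theorem eq_plus_iff_exists_norm_of_value_near_fixed [CompleteSpace E] {σ : E →+* E} {ϖ : E} {d t : ℕ} (hD : IsRamifiedQuadraticDatum σ ϖ d t)
    {L : Set V} {val : V → E} {e' : E} (he'σ : σ e' = e') (he'1 : Valued.v e' = 1)
    (hS : {z : E | ∃ y ∈ L, Valued.v ((ϖ ^ mstarOfRecord d)⁻¹ * (z - val y)) ≤ 1} = valueSetMod σ ϖ (mstarOfRecord d) (e' • xPlus σ ϖ d))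
    {y : V} (hy : y ∈ L) {e'' : E} (he''σ : σ e'' = e'') (he''1 : Valued.v e'' = 1)
    (hclose : Valued.v (val y - e'' * ((ϖ - σ ϖ) * ((ϖ * σ ϖ) ^ ((d - d % 2) / 2))⁻¹)) ≤ Valued.v ϖ ^ mstarOfRecord d) :
    {z : E | ∃ y ∈ L, Valued.v ((ϖ ^ mstarOfRecord d)⁻¹ * (z - val y)) ≤ 1} = valueSetMod σ ϖ (mstarOfRecord d) (xPlus σ ϖ d) ↔
      ∃ z : E, z * σ z = e'' := by
  haveI := isAdicComplete_valuedInteger_of_completeSpace (K := E) hD.2.2.1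
  obtain ⟨z, hz⟩ := exists_norm_of_value_near_fixed hD he'σ he'1 hS hy he''σ he''1 hclose
  have he'0 : e' ≠ 0 := fun h0 => by rw [h0, map_zero] at he'1; exact zero_ne_one he'1
  rw [hS, valueSetMod_smul_xPlus_eq_plus_iff_exists_norm hD he'σ he'1]
  -- `e″ = (z σz)·e′`: norms differ by norms
  constructor
  · rintro ⟨w, hw⟩
    exact ⟨z * w, by rw [map_mul, mul_mul_mul_comm, hz, hw, inv_mul_cancel_right₀ he'0]⟩
  · rintro ⟨w, hw⟩
    have hz0 : z ≠ 0 := fun h0 => by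
      have e0 : e'' * e'⁻¹ = 0 := by rw [← hz, h0, zero_mul]
      rcases mul_eq_zero.1 e0 with h | h
      · rw [h, map_zero] at he''1; exact zero_ne_one he''1
      · exact he'0 (inv_eq_zero.1 h)
    refine ⟨w / z, ?_⟩
    rw [map_div₀, div_mul_div_comm, hw, hz, div_eq_iff (mul_ne_zero hz0 ((map_ne_zero σ).2 hz0) |> fun h => by rw [hz] at h; exact h)]
    rw [mul_comm e'' e'⁻¹, ← mul_assoc, mul_inv_cancel₀ he'0, one_mul]

end Summit.HodgeConjecture.HodgeConjecture.Cruxes.H413.F0P3cDyRamCleanShellLabelRead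

end
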